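import Mathlib
import HarnessLib

/-!
# Painlevé–Kuratowski limits of sequences of sets and epi-convergence

Literature anchor transcribing J. M. Borwein, Q. J. Zhu, *Techniques of Variational Analysis*,
CMS Books in Mathematics 20, Springer (2005) [BorweinZhu2005] (held: `lit` key
`book:borwein2005-techniques-variational-analysis`), **§5.1.3 "Limits of Sequences of Sets"**,
printed pp. 169–173 (index entries "sequence of sets: lower limit, upper limit,
Painlevé–Kuratowski limit 169", "epi-convergence 170", "epi-limit 171", "argmin 166"):
Definition 5.1.9, the representations (5.1.3)–(5.1.4) (Exercise 5.1.6), Lemma 5.1.10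
(Exercise 5.1.7), Lemma 5.1.11 (Exercise 5.1.9), Definition 5.1.12, Exercise 5.1.11,
Lemma 5.1.13 (Exercise 5.1.12), Theorem 5.1.14 and Exercise 5.1.13.
Everything is proved; there are no named facts and no `sorry`.

## What is formalised

`Y` is a topological space (the book: Hausdorff; separation is never used), `F : ℕ → Set Y`.

* [BZ05, Def 5.1.9] `seqLiminf F` = the sequential lower limit `lim inf Fᵢ` (limits of sequences
  `yᵢ ∈ Fᵢ`), `seqLimsup F` = the sequential upper limit `lim sup Fᵢ` (limits of sequences
  `y_k ∈ F_{i_k}` along indices `i_k → ∞`), `IsSeqLimit F S` = "`S` is the Painlevé–Kuratowski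
  limit of `(Fᵢ)`" (`lim inf Fᵢ = S = lim sup Fᵢ`); "Clearly `lim inf ⊆ lim sup`"
  (`seqLiminf_subset_seqLimsup`), so `IsSeqLimit F S ↔ lim sup Fᵢ ⊆ S ⊆ lim inf Fᵢ`
  (`isSeqLimit_iff`); `i_k → ∞` may be taken strictly increasing
  (`mem_seqLimsup_iff_strictMono`).
* [BZ05, p. 169] "In a metric space both the sequential lower and upper limits are closed":
  `isClosed_seqLiminf`, `isClosed_seqLimsup` (pseudo-e-metric spaces).
* [BZ05, (5.1.3)–(5.1.4), Exercise 5.1.6] with `B_r(S) = {y | d(S; y) < r}` = Mathlib's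
  `Metric.thickening r S`: `lim inf Fᵢ = ⋂ₖ ⋃ⱼ ⋂_{i ≥ j} B_{1/k}(Fᵢ)` and
  `lim sup Fᵢ = ⋂ₖ ⋂ⱼ ⋃_{i ≥ j} B_{1/k}(Fᵢ)` (`seqLiminf_eq_iInter_thickening`,
  `seqLimsup_eq_iInter_thickening`; `k` runs over `ℕ` with radius `1/(k+1)`).
* [BZ05, Lemma 5.1.10, Exercise 5.1.7] with `d(S; y) = Metric.infEDist y S ∈ [0, ∞]`:
  `y ∈ lim inf Fᵢ ↔ lim sup d(Fᵢ; y) = 0 ↔ d(Fᵢ; y) → 0`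
  (`mem_seqLiminf_iff_limsup_eq_zero`, `mem_seqLiminf_iff_tendsto_infEDist`) and
  `y ∈ lim sup Fᵢ ↔ lim inf d(Fᵢ; y) = 0 ↔ ∀ ε > 0, d(Fᵢ; y) < ε frequently`
  (`mem_seqLimsup_iff_liminf_eq_zero`, `mem_seqLimsup_iff_frequently`).
* [BZ05, Lemma 5.1.11] `F ⊆ lim inf Fᵢ ↔ ∀ y, lim sup d(Fᵢ; y) ≤ d(F; y)`
  (`subset_seqLiminf_iff`, any `F`); `(∀ y, d(F; y) ≤ lim inf d(Fᵢ; y)) → lim sup Fᵢ ⊆ F` for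
  closed `F` (`seqLimsup_subset_of_infEDist_le_liminf`) and the converse in proper metric spaces
  (`infEDist_le_liminf_of_seqLimsup_subset`, see Deviations); consequently
  `d(Fᵢ; ·) → d(F; ·)` pointwise implies `lim Fᵢ = F` for closed `F`
  (`isSeqLimit_of_tendsto_infEDist`), with converse in proper spaces
  (`tendsto_infEDist_of_isSeqLimit`).
* [BZ05, Def 5.1.12] for `f : ℕ → X → EReal`, `g : X → EReal` and the epigraph
  `epi h = {(x, r) ∈ X × ℝ | h x ≤ r}`: `IsLowerEpiLimit f g` ("`g = e-lim infᵢ fᵢ`":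
  `epi g = lim sup (epi fᵢ)`), `IsUpperEpiLimit f g` ("`g = e-lim supᵢ fᵢ`":
  `epi g = lim inf (epi fᵢ)`), `EpiConverges f g` ("`fᵢ` epi-converges to `g`": both).
  A function is determined by its epigraph (`eq_of_epi_eq`), so these limits are unique
  (`IsLowerEpiLimit.unique`, `IsUpperEpiLimit.unique`).
* [BZ05, Exercise 5.1.11] lower and upper epi-limits (hence epi-limits) are lsc
  (`IsLowerEpiLimit.lowerSemicontinuous`, `IsUpperEpiLimit.lowerSemicontinuous`,
  `EpiConverges.lowerSemicontinuous`), via `lowerSemicontinuous_of_isClosed_epi`.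
* [BZ05, Lemma 5.1.13, Exercise 5.1.12] in a metric space, `g = e-lim fᵢ` iff at each `x`
  (5.1.9) `lim inf fᵢ(xᵢ) ≥ g(x)` for every sequence `xᵢ → x` and
  (5.1.10) `lim sup fᵢ(xᵢ) ≤ g(x)` for some sequence `xᵢ → x` (`epiConverges_iff`; the four
  implications separately: `IsLowerEpiLimit.le_liminf`, `IsUpperEpiLimit.exists_limsup_le`,
  `seqLimsup_epi_subset_of_le_liminf`, `epi_subset_seqLiminf_of_exists_limsup_le`).
* [BZ05, Thm 5.1.14] if `fᵢ` epi-converges to `g` and all `dom fᵢ = {fᵢ < +∞}` lie in one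
  compact set `E`, then (5.1.11) `inf fᵢ → inf g` (`EpiConverges.tendsto_iInf`) and (5.1.12)
  `lim sup (argmin fᵢ) ⊆ argmin g` (`EpiConverges.seqLimsup_argmin_subset`, which — as the book
  remarks after the proof — needs no compactness); [BZ05, Exercise 5.1.13] without the compact
  set `E`, (5.1.11) fails (`exists_epiConverges_not_tendsto_iInf`: `fᵢ = ι_{{i}}` on `ℝ`).

## Deviations

(i) `seqLiminf` asks for `xᵢ ∈ Fᵢ` for all sufficiently large `i` rather than for all `i`; the
two agree as soon as every `Fᵢ` is nonempty (`mem_seqLiminf_iff_forall`), and the book's own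
representation (5.1.3) and Lemma 5.1.10 are the "eventually" version (with "for all `i`" they
fail when a single `Fᵢ` is empty).  (ii) Distances to sets are Mathlib's extended-valued
`Metric.infEDist` (`d(∅; y) = +∞`, as in the book's `inf ∅ = +∞`); spaces are pseudo-(e)metric.
(iii) In Lemma 5.1.11 the implication (5.1.7) ⇒ (5.1.8) ("similar and left as Exercise 5.1.9")
is false in general metric spaces — in `ℓ²` take `Fᵢ = {eᵢ}`, `F = {3e₁}`, `y = 0`: then
`lim sup Fᵢ = ∅ ⊆ F` but `lim inf d(Fᵢ; 0) = 1 < 3 = d(F; 0)` — so it is proved for proper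
metric spaces (bounded sequences have convergent subsequences), which covers `ℝᴺ`.
(iv) Functions take values in `EReal = [−∞, +∞]` (the book writes `ℝ`, resp. `ℝ ∪ {+∞}`, but uses
`dom f`); epigraphs live in `X × ℝ` as in the book; epi-limits are recorded as predicates
("`g` is the lower/upper epi-limit") rather than as functions.  (v) Theorem 5.1.14 is proved
without the lower semicontinuity of the `fᵢ` and without `dom g ⊆ E` (not needed);
`argmin h = {x | ∀ y, h x ≤ h y}` and `inf h = ⨅ x, h x ∈ EReal`.

## Related material (not imported)

Mathlib has `Metric.thickening`, `Metric.infEDist` and, for §5.1.4 of the book (not transcribed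
here), upper/lower hemicontinuity of set-valued maps (`UpperHemicontinuous`,
`LowerHemicontinuous`), but no Painlevé–Kuratowski limits and no epi-convergence.  In the tree,
`Literature/Topology/Metrizable/KuratowskiLimit.lean` writes out the topological lower limit
`{x | ∀ open O ∋ x, ∀ᶠ i, (Mᵢ ∩ O).Nonempty}` and extracts subsequences along which it is a limit
(second-countable spaces); `Literature/Topology/PlaneTopology/ConnectedImKleinen.lean` has the
topological upper limit `Ls Dₙ = {x | ∀ r > 0, ∃ᶠ n, (Dₙ ∩ B(x, r)).Nonempty}` of a sequence of
sets in a metric space (closed; connectedness of upper limits of continua); and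
`Literature/MathematicalPhysics/StatisticalMechanics/LocalMatchingCompactness.lean` has a
`kuratowskiLiminf` in `ℝᵈ` via `dist`.  The present file transcribes Borwein–Zhu's sequential
definitions in a general topological space and proves (Lemma 5.1.10) that in metric spaces they
are exactly these distance/ball descriptions; Lemma 5.1.11, epi-limits, Lemma 5.1.13 and
Theorem 5.1.14 are not in the tree or in Mathlib.
-/

open Set Filter Topology
open scoped ENNReal

namespace Literature.Analysis.Convex.PainleveKuratowskiEpiConvergence

/-! ## Definition 5.1.9: sequential lower and upper limits of a sequence of sets -/

section Definitions

variable {Y : Type*} [TopologicalSpace Y]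

/-- The **sequential lower limit** `lim infᵢ Fᵢ` of a sequence of sets: all limits of sequences
`(yᵢ)` with `yᵢ ∈ Fᵢ` (for all sufficiently large `i`, see Deviation (i)).
[cite: BorweinZhu2005, Def 5.1.9] -/
def seqLiminf (F : ℕ → Set Y) : Set Y :=
  {y | ∃ x : ℕ → Y, (∀ᶠ i in atTop, x i ∈ F i) ∧ Tendsto x atTop (𝓝 y)}

/-- The **sequential upper limit** `lim supᵢ Fᵢ` of a sequence of sets: all limits of sequences
`(y_k)` with `y_k ∈ F_{i_k}` for some indices `i_k → ∞`. [cite: BorweinZhu2005, Def 5.1.9] -/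
def seqLimsup (F : ℕ → Set Y) : Set Y :=
  {y | ∃ φ : ℕ → ℕ, Tendsto φ atTop atTop ∧
    ∃ x : ℕ → Y, (∀ k, x k ∈ F (φ k)) ∧ Tendsto x atTop (𝓝 y)}

/-- `S` is the **Painlevé–Kuratowski limit** `limᵢ Fᵢ` of the sequence `(Fᵢ)`: the lower and the
upper limit both equal `S`. [cite: BorweinZhu2005, Def 5.1.9] -/
def IsSeqLimit (F : ℕ → Set Y) (S : Set Y) : Prop :=
  seqLiminf F = S ∧ seqLimsup F = S

/-- Unfolding of `seqLiminf`. [cite: BorweinZhu2005, Def 5.1.9] -/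
theorem mem_seqLiminf_iff {F : ℕ → Set Y} {y : Y} :
    y ∈ seqLiminf F ↔ ∃ x : ℕ → Y, (∀ᶠ i in atTop, x i ∈ F i) ∧ Tendsto x atTop (𝓝 y) :=
  Iff.rfl

/-- Unfolding of `seqLimsup`. [cite: BorweinZhu2005, Def 5.1.9] -/
theorem mem_seqLimsup_iff {F : ℕ → Set Y} {y : Y} :
    y ∈ seqLimsup F ↔ ∃ φ : ℕ → ℕ, Tendsto φ atTop atTop ∧
      ∃ x : ℕ → Y, (∀ k, x k ∈ F (φ k)) ∧ Tendsto x atTop (𝓝 y) :=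
  Iff.rfl

/-- A limit of a sequence `yᵢ ∈ Fᵢ` lies in `lim inf Fᵢ`. [cite: BorweinZhu2005, Def 5.1.9] -/
theorem mem_seqLiminf_of_tendsto {F : ℕ → Set Y} {y : Y} {x : ℕ → Y} (hx : ∀ i, x i ∈ F i)
    (h : Tendsto x atTop (𝓝 y)) : y ∈ seqLiminf F :=
  ⟨x, Eventually.of_forall hx, h⟩

/-- When every `Fᵢ` is nonempty, `lim inf Fᵢ` is literally the set of limits of sequences with
`yᵢ ∈ Fᵢ` for all `i = 1, 2, …` (the book's wording). [cite: BorweinZhu2005, Def 5.1.9] -/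
theorem mem_seqLiminf_iff_forall {F : ℕ → Set Y} (hF : ∀ i, (F i).Nonempty) {y : Y} :
    y ∈ seqLiminf F ↔ ∃ x : ℕ → Y, (∀ i, x i ∈ F i) ∧ Tendsto x atTop (𝓝 y) := by
  classical
  refine ⟨fun ⟨x, hx, hxy⟩ => ?_, fun ⟨x, hx, hxy⟩ => ⟨x, Eventually.of_forall hx, hxy⟩⟩
  obtain ⟨N, hN⟩ := eventually_atTop.1 hx
  refine ⟨fun i => if N ≤ i then x i else (hF i).some, fun i => ?_, ?_⟩
  · by_cases hi : N ≤ i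
    · show (if N ≤ i then x i else (hF i).some) ∈ F i
      rw [if_pos hi]; exact hN i hi
    · show (if N ≤ i then x i else (hF i).some) ∈ F i
      rw [if_neg hi]; exact (hF i).some_mem
  · refine hxy.congr' ?_
    filter_upwards [eventually_ge_atTop N] with i hi
    rw [if_pos hi]

/-- A limit of a sequence `y_k ∈ F_{φ k}` along a strictly increasing `φ` lies in `lim sup Fᵢ`.
[cite: BorweinZhu2005, Def 5.1.9] -/
theorem mem_seqLimsup_of_tendsto {F : ℕ → Set Y} {y : Y} {φ : ℕ → ℕ} (hφ : StrictMono φ)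
    {x : ℕ → Y} (hx : ∀ k, x k ∈ F (φ k)) (h : Tendsto x atTop (𝓝 y)) : y ∈ seqLimsup F :=
  ⟨φ, hφ.tendsto_atTop, x, hx, h⟩

/-- In `lim sup Fᵢ` the indices `i_k → ∞` may be taken strictly increasing.
[cite: BorweinZhu2005, Def 5.1.9] -/
theorem mem_seqLimsup_iff_strictMono {F : ℕ → Set Y} {y : Y} :
    y ∈ seqLimsup F ↔ ∃ φ : ℕ → ℕ, StrictMono φ ∧
      ∃ x : ℕ → Y, (∀ k, x k ∈ F (φ k)) ∧ Tendsto x atTop (𝓝 y) := by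
  refine ⟨fun ⟨φ, hφ, x, hx, hxy⟩ => ?_,
    fun ⟨φ, hφ, x, hx, hxy⟩ => ⟨φ, hφ.tendsto_atTop, x, hx, hxy⟩⟩
  obtain ⟨ψ, hψ, hφψ⟩ := strictMono_subseq_of_tendsto_atTop hφ
  exact ⟨φ ∘ ψ, hφψ, x ∘ ψ, fun k => hx (ψ k), hxy.comp hψ.tendsto_atTop⟩

/-- "Clearly `lim infᵢ Fᵢ ⊆ lim supᵢ Fᵢ`." [cite: BorweinZhu2005, Def 5.1.9 (p. 169)] -/
theorem seqLiminf_subset_seqLimsup (F : ℕ → Set Y) : seqLiminf F ⊆ seqLimsup F := by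
  rintro y ⟨x, hx, hxy⟩
  obtain ⟨N, hN⟩ := eventually_atTop.1 hx
  exact ⟨fun k => k + N, tendsto_add_atTop_nat N, fun k => x (k + N),
    fun k => hN _ (Nat.le_add_left N k), hxy.comp (tendsto_add_atTop_nat N)⟩

/-- Monotonicity of the lower limit in the sets. [cite: BorweinZhu2005, Def 5.1.9] -/
theorem seqLiminf_mono {F G : ℕ → Set Y} (h : ∀ i, F i ⊆ G i) : seqLiminf F ⊆ seqLiminf G :=
  fun _ ⟨x, hx, hxy⟩ => ⟨x, hx.mono fun i hi => h i hi, hxy⟩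

/-- Monotonicity of the upper limit in the sets. [cite: BorweinZhu2005, Def 5.1.9] -/
theorem seqLimsup_mono {F G : ℕ → Set Y} (h : ∀ i, F i ⊆ G i) : seqLimsup F ⊆ seqLimsup G :=
  fun _ ⟨φ, hφ, x, hx, hxy⟩ => ⟨φ, hφ, x, fun k => h _ (hx k), hxy⟩

/-- `limᵢ Fᵢ = S` iff `lim sup Fᵢ ⊆ S ⊆ lim inf Fᵢ`. [cite: BorweinZhu2005, Def 5.1.9] -/
theorem isSeqLimit_iff {F : ℕ → Set Y} {S : Set Y} :
    IsSeqLimit F S ↔ seqLimsup F ⊆ S ∧ S ⊆ seqLiminf F := by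
  constructor
  · rintro ⟨h₁, h₂⟩
    exact ⟨h₂.le, h₁.ge⟩
  · rintro ⟨h₁, h₂⟩
    exact ⟨Subset.antisymm ((seqLiminf_subset_seqLimsup F).trans h₁) h₂,
      Subset.antisymm h₁ (h₂.trans (seqLiminf_subset_seqLimsup F))⟩

end Definitions

/-! ## Lemma 5.1.10, closedness, (5.1.3)–(5.1.4) and Lemma 5.1.11 in (pseudo-e-)metric spaces -/

section PseudoEMetric

open Metric

variable {Y : Type*} [PseudoEMetricSpace Y]

/-- `((i : ℝ≥0∞) + 1)⁻¹ → 0`. [folklore] -/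
private theorem tendsto_inv_natCast_succ :
    Tendsto (fun i : ℕ => ((i : ℝ≥0∞) + 1)⁻¹) atTop (𝓝 0) := by
  have h := ENNReal.tendsto_inv_nat_nhds_zero.comp (tendsto_add_atTop_nat 1)
  refine h.congr fun i => ?_
  simp only [Function.comp_apply, Nat.cast_add, Nat.cast_one]

/-- **Lemma 5.1.10** (lower limit): `y ∈ lim infᵢ Fᵢ` iff `d(Fᵢ; y) → 0`.
[cite: BorweinZhu2005, Lemma 5.1.10 & Exercise 5.1.7] -/
theorem mem_seqLiminf_iff_tendsto_infEDist {F : ℕ → Set Y} {y : Y} :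
    y ∈ seqLiminf F ↔ Tendsto (fun i => infEDist y (F i)) atTop (𝓝 0) := by
  constructor
  · rintro ⟨x, hx, hxy⟩
    have h0 : Tendsto (fun i => edist (x i) y) atTop (𝓝 0) := tendsto_iff_edist_tendsto_0.1 hxy
    refine tendsto_of_tendsto_of_tendsto_of_le_of_le' tendsto_const_nhds h0
      (Eventually.of_forall fun i => zero_le) ?_
    filter_upwards [hx] with i hi
    rw [edist_comm]
    exact infEDist_le_edist_of_mem hi
  · intro h
    haveI : Nonempty Y := ⟨y⟩
    have hfin : ∀ᶠ i in atTop, infEDist y (F i) < ⊤ :=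
      h.eventually (gt_mem_nhds ENNReal.zero_lt_top)
    have hchoice : ∀ i : ℕ, infEDist y (F i) < ⊤ →
        ∃ z ∈ F i, edist y z < infEDist y (F i) + ((i : ℝ≥0∞) + 1)⁻¹ := fun i hi =>
      infEDist_lt_iff.1 (ENNReal.lt_add_right hi.ne (by simp))
    choose! z hzF hzd using hchoice
    refine ⟨z, hfin.mono fun i hi => hzF i hi, ?_⟩
    rw [tendsto_iff_edist_tendsto_0]
    have hsum : Tendsto (fun i : ℕ => infEDist y (F i) + ((i : ℝ≥0∞) + 1)⁻¹) atTop (𝓝 0) := by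
      simpa using h.add tendsto_inv_natCast_succ
    refine tendsto_of_tendsto_of_tendsto_of_le_of_le' tendsto_const_nhds hsum
      (Eventually.of_forall fun i => zero_le) ?_
    filter_upwards [hfin] with i hi
    rw [edist_comm]
    exact (hzd i hi).le

/-- In `[0, ∞]`, `uᵢ → 0` iff `lim sup uᵢ = 0`. [folklore] -/
private theorem ennreal_tendsto_zero_iff_limsup {u : ℕ → ℝ≥0∞} :
    Tendsto u atTop (𝓝 0) ↔ limsup u atTop = 0 :=
  ⟨fun h => h.limsup_eq, fun h => tendsto_of_le_liminf_of_limsup_le zero_le h.le⟩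

/-- In `[0, ∞]`, `lim inf uᵢ = 0` iff `uᵢ < ε` frequently, for every `ε > 0`. [folklore] -/
private theorem ennreal_liminf_eq_zero_iff {u : ℕ → ℝ≥0∞} :
    liminf u atTop = 0 ↔ ∀ ε, 0 < ε → ∃ᶠ i in atTop, u i < ε := by
  constructor
  · intro h ε hε
    exact frequently_lt_of_liminf_lt (h := h.trans_lt hε)
  · intro h
    by_contra hne
    obtain ⟨b, hb0, hb⟩ := exists_between (pos_iff_ne_zero.2 hne)
    exact ((h b hb0).and_eventually (eventually_lt_of_lt_liminf hb)).exists.elim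
      fun i hi => lt_asymm hi.1 hi.2

/-- **Lemma 5.1.10** (lower limit, book's form): `y ∈ lim infᵢ Fᵢ` iff `lim supᵢ d(Fᵢ; y) = 0`.
[cite: BorweinZhu2005, Lemma 5.1.10 & Exercise 5.1.7] -/
theorem mem_seqLiminf_iff_limsup_eq_zero {F : ℕ → Set Y} {y : Y} :
    y ∈ seqLiminf F ↔ limsup (fun i => infEDist y (F i)) atTop = 0 :=
  mem_seqLiminf_iff_tendsto_infEDist.trans ennreal_tendsto_zero_iff_limsup

/-- **Lemma 5.1.10** (upper limit): `y ∈ lim supᵢ Fᵢ` iff for every `ε > 0`, `d(Fᵢ; y) < ε` for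
infinitely many `i`. [cite: BorweinZhu2005, Lemma 5.1.10 & Exercise 5.1.7] -/
theorem mem_seqLimsup_iff_frequently {F : ℕ → Set Y} {y : Y} :
    y ∈ seqLimsup F ↔ ∀ ε, 0 < ε → ∃ᶠ i in atTop, infEDist y (F i) < ε := by
  constructor
  · rintro ⟨φ, hφ, x, hx, hxy⟩ ε hε
    rw [frequently_atTop]
    intro N
    have h1 : ∀ᶠ k in atTop, N ≤ φ k := hφ.eventually (eventually_ge_atTop N)
    have h2 : ∀ᶠ k in atTop, edist (x k) y < ε := (tendsto_iff_edist_tendsto_0.1 hxy).eventually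
      (gt_mem_nhds hε)
    obtain ⟨k, hk1, hk2⟩ := (h1.and h2).exists
    refine ⟨φ k, hk1, ?_⟩
    calc infEDist y (F (φ k)) ≤ edist y (x k) := infEDist_le_edist_of_mem (hx k)
      _ = edist (x k) y := edist_comm _ _
      _ < ε := hk2
  · intro h
    haveI : Nonempty Y := ⟨y⟩
    have hP : ∀ n : ℕ, ∃ᶠ i in atTop, infEDist y (F i) < ((n : ℝ≥0∞) + 1)⁻¹ := fun n =>
      h _ (ENNReal.inv_pos.2 (by simp))
    obtain ⟨φ, hφ, hφP⟩ := extraction_forall_of_frequently hP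
    have hchoice : ∀ k : ℕ, ∃ z ∈ F (φ k), edist y z < ((k : ℝ≥0∞) + 1)⁻¹ := fun k =>
      infEDist_lt_iff.1 (hφP k)
    choose z hzF hzd using hchoice
    refine ⟨φ, hφ.tendsto_atTop, z, hzF, ?_⟩
    rw [tendsto_iff_edist_tendsto_0]
    refine tendsto_of_tendsto_of_tendsto_of_le_of_le' tendsto_const_nhds tendsto_inv_natCast_succ
      (Eventually.of_forall fun i => zero_le) (Eventually.of_forall fun k => ?_)
    rw [edist_comm]
    exact (hzd k).le

/-- **Lemma 5.1.10** (upper limit, book's form): `y ∈ lim supᵢ Fᵢ` iff `lim infᵢ d(Fᵢ; y) = 0`.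
[cite: BorweinZhu2005, Lemma 5.1.10 & Exercise 5.1.7] -/
theorem mem_seqLimsup_iff_liminf_eq_zero {F : ℕ → Set Y} {y : Y} :
    y ∈ seqLimsup F ↔ liminf (fun i => infEDist y (F i)) atTop = 0 :=
  mem_seqLimsup_iff_frequently.trans ennreal_liminf_eq_zero_iff.symm

/-- "In a metric space both the sequential lower and upper limits are closed" — lower limit.
[cite: BorweinZhu2005, Def 5.1.9 (p. 169)] -/
theorem isClosed_seqLiminf (F : ℕ → Set Y) : IsClosed (seqLiminf F) := by
  refine isClosed_of_closure_subset fun y hy => ?_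
  rw [EMetric.mem_closure_iff] at hy
  rw [mem_seqLiminf_iff_tendsto_infEDist]
  refine tendsto_order.2 ⟨fun b hb => (ENNReal.not_lt_zero hb).elim, fun ε hε => ?_⟩
  obtain ⟨z, hz, hyz⟩ := hy (ε / 2) (ENNReal.half_pos hε.ne')
  have hz' := (tendsto_order.1 (mem_seqLiminf_iff_tendsto_infEDist.1 hz)).2 (ε / 2)
    (ENNReal.half_pos hε.ne')
  filter_upwards [hz'] with i hi
  calc infEDist y (F i) ≤ infEDist z (F i) + edist y z := infEDist_le_infEDist_add_edist
    _ < ε / 2 + ε / 2 := ENNReal.add_lt_add hi hyz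
    _ = ε := ENNReal.add_halves ε

/-- "In a metric space both the sequential lower and upper limits are closed" — upper limit.
[cite: BorweinZhu2005, Def 5.1.9 (p. 169)] -/
theorem isClosed_seqLimsup (F : ℕ → Set Y) : IsClosed (seqLimsup F) := by
  refine isClosed_of_closure_subset fun y hy => ?_
  rw [EMetric.mem_closure_iff] at hy
  rw [mem_seqLimsup_iff_frequently]
  intro ε hε
  obtain ⟨z, hz, hyz⟩ := hy (ε / 2) (ENNReal.half_pos hε.ne')
  have hz' := mem_seqLimsup_iff_frequently.1 hz (ε / 2) (ENNReal.half_pos hε.ne')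
  refine hz'.mono fun i hi => ?_
  calc infEDist y (F i) ≤ infEDist z (F i) + edist y z := infEDist_le_infEDist_add_edist
    _ < ε / 2 + ε / 2 := ENNReal.add_lt_add hi hyz
    _ = ε := ENNReal.add_halves ε

/-- `∀ ε > 0` versus `∀ k, … < 1/(k+1)` for eventual smallness in `[0, ∞]`. [folklore] -/
private theorem forall_pos_iff_forall_inv_succ {P : ℝ≥0∞ → Prop}
    (hP : ∀ ⦃a b⦄, a ≤ b → P a → P b) :
    (∀ ε, 0 < ε → P ε) ↔ ∀ k : ℕ, P ((k : ℝ≥0∞) + 1)⁻¹ := by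
  refine ⟨fun h k => h _ (ENNReal.inv_pos.2 (by simp)), fun h ε hε => ?_⟩
  obtain ⟨n, hn⟩ := ENNReal.exists_inv_nat_lt hε.ne'
  have hle : ((n : ℝ≥0∞) + 1)⁻¹ ≤ (n : ℝ≥0∞)⁻¹ := ENNReal.inv_le_inv.2 (by simp)
  exact hP (hle.trans hn.le) (h n)

/-- The radius `1/(k+1)` as an extended nonnegative real. [folklore] -/
private theorem ofReal_one_div_succ (k : ℕ) :
    ENNReal.ofReal (1 / ((k : ℝ) + 1)) = ((k : ℝ≥0∞) + 1)⁻¹ := by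
  rw [one_div, ENNReal.ofReal_inv_of_pos (by positivity)]
  congr 1
  rw [ENNReal.ofReal_add (by positivity) zero_le_one, ENNReal.ofReal_natCast, ENNReal.ofReal_one]

/-- **(5.1.3)** `lim infᵢ Fᵢ = ⋂_{k} ⋃_{j} ⋂_{i ≥ j} B_{1/(k+1)}(Fᵢ)` with
`B_r(S) = {y | d(S; y) < r}` (`Metric.thickening`).
[cite: BorweinZhu2005, (5.1.3) & Exercise 5.1.6] -/
theorem seqLiminf_eq_iInter_thickening (F : ℕ → Set Y) :
    seqLiminf F = ⋂ k : ℕ, ⋃ j : ℕ, ⋂ i ≥ j, thickening (1 / ((k : ℝ) + 1)) (F i) := by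
  ext y
  rw [mem_seqLiminf_iff_tendsto_infEDist]
  have key : Tendsto (fun i => infEDist y (F i)) atTop (𝓝 0) ↔
      ∀ k : ℕ, ∀ᶠ i in atTop, infEDist y (F i) < ((k : ℝ≥0∞) + 1)⁻¹ := by
    rw [tendsto_order]
    simp only [ENNReal.not_lt_zero, IsEmpty.forall_iff, implies_true, true_and]
    exact forall_pos_iff_forall_inv_succ fun a b hab h => h.mono fun i hi => hi.trans_le hab
  rw [key]
  simp only [mem_iInter, mem_iUnion, eventually_atTop, mem_thickening_iff_infEDist_lt,
    ofReal_one_div_succ]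

/-- **(5.1.4)** `lim supᵢ Fᵢ = ⋂_{k} ⋂_{j} ⋃_{i ≥ j} B_{1/(k+1)}(Fᵢ)` with
`B_r(S) = {y | d(S; y) < r}` (`Metric.thickening`).
[cite: BorweinZhu2005, (5.1.4) & Exercise 5.1.6] -/
theorem seqLimsup_eq_iInter_thickening (F : ℕ → Set Y) :
    seqLimsup F = ⋂ k : ℕ, ⋂ j : ℕ, ⋃ i ≥ j, thickening (1 / ((k : ℝ) + 1)) (F i) := by
  ext y
  rw [mem_seqLimsup_iff_frequently]
  rw [forall_pos_iff_forall_inv_succ (P := fun ε => ∃ᶠ i in atTop, infEDist y (F i) < ε)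
    fun a b hab h => h.mono fun i hi => hi.trans_le hab]
  simp only [mem_iInter, mem_iUnion, frequently_atTop, mem_thickening_iff_infEDist_lt,
    ofReal_one_div_succ, exists_prop]

/-- **Lemma 5.1.11**, (5.1.5) ⇔ (5.1.6): `F ⊆ lim infᵢ Fᵢ` iff
`lim supᵢ d(Fᵢ; y) ≤ d(F; y)` for every `y`. [cite: BorweinZhu2005, Lemma 5.1.11] -/
theorem subset_seqLiminf_iff {Fs : ℕ → Set Y} {F : Set Y} :
    F ⊆ seqLiminf Fs ↔ ∀ y, limsup (fun i => infEDist y (Fs i)) atTop ≤ infEDist y F := by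
  constructor
  · intro h y
    refine le_of_forall_gt_imp_ge_of_dense fun c hc => ?_
    obtain ⟨z, hzF, hyz⟩ := infEDist_lt_iff.1 hc
    obtain ⟨x, hx, hxz⟩ := h hzF
    have hlim : Tendsto (fun i => edist y (x i)) atTop (𝓝 (edist y z)) :=
      tendsto_const_nhds.edist hxz
    calc limsup (fun i => infEDist y (Fs i)) atTop ≤ limsup (fun i => edist y (x i)) atTop :=
          limsup_le_limsup (hx.mono fun i hi => infEDist_le_edist_of_mem hi)
      _ = edist y z := hlim.limsup_eq
      _ ≤ c := hyz.le
  · intro h y hy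
    rw [mem_seqLiminf_iff_limsup_eq_zero]
    exact le_antisymm ((h y).trans (infEDist_zero_of_mem hy).le) zero_le

/-- **Lemma 5.1.11**, (5.1.8) ⇒ (5.1.7): if `d(F; y) ≤ lim infᵢ d(Fᵢ; y)` for every `y` and `F`
is closed, then `lim supᵢ Fᵢ ⊆ F`. [cite: BorweinZhu2005, Lemma 5.1.11 & Exercise 5.1.9] -/
theorem seqLimsup_subset_of_infEDist_le_liminf {Fs : ℕ → Set Y} {F : Set Y} (hF : IsClosed F)
    (h : ∀ y, infEDist y F ≤ liminf (fun i => infEDist y (Fs i)) atTop) :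
    seqLimsup Fs ⊆ F := by
  intro y hy
  rw [mem_seqLimsup_iff_liminf_eq_zero] at hy
  rw [← hF.closure_eq, mem_closure_iff_infEDist_zero]
  exact le_antisymm ((h y).trans hy.le) zero_le

/-- **Lemma 5.1.11**, "consequently" (the direction valid in every metric space): if
`d(Fᵢ; y) → d(F; y)` for every `y` and `F` is closed, then `limᵢ Fᵢ = F`.
[cite: BorweinZhu2005, Lemma 5.1.11] -/
theorem isSeqLimit_of_tendsto_infEDist {Fs : ℕ → Set Y} {F : Set Y} (hF : IsClosed F)
    (h : ∀ y, Tendsto (fun i => infEDist y (Fs i)) atTop (𝓝 (infEDist y F))) :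
    IsSeqLimit Fs F := by
  rw [isSeqLimit_iff]
  exact ⟨seqLimsup_subset_of_infEDist_le_liminf hF fun y => (h y).liminf_eq.ge,
    subset_seqLiminf_iff.2 fun y => (h y).limsup_eq.le⟩

end PseudoEMetric

section Proper

open Metric

variable {Y : Type*} [PseudoMetricSpace Y] [ProperSpace Y]

/-- **Lemma 5.1.11**, (5.1.7) ⇒ (5.1.8) in a proper metric space (e.g. `ℝᴺ`; false in general,
see Deviation (iii)): if `lim supᵢ Fᵢ ⊆ F` then `d(F; y) ≤ lim infᵢ d(Fᵢ; y)` for every `y`.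
[cite: BorweinZhu2005, Lemma 5.1.11 & Exercise 5.1.9] -/
theorem infEDist_le_liminf_of_seqLimsup_subset {Fs : ℕ → Set Y} {F : Set Y}
    (h : seqLimsup Fs ⊆ F) (y : Y) :
    infEDist y F ≤ liminf (fun i => infEDist y (Fs i)) atTop := by
  by_contra hlt
  rw [not_le] at hlt
  obtain ⟨c, hc1, hc2⟩ := exists_between hlt
  have hc_top : c ≠ ⊤ := ne_top_of_lt hc2
  obtain ⟨φ, hφ, hφc⟩ := extraction_of_frequently_atTop (frequently_lt_of_liminf_lt (h := hc1))
  have hchoice : ∀ k : ℕ, ∃ z ∈ Fs (φ k), edist y z < c := fun k => infEDist_lt_iff.1 (hφc k)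
  choose z hzF hzd using hchoice
  have hball : ∀ k, z k ∈ closedBall y c.toReal := fun k => by
    rw [mem_closedBall, dist_comm]
    have := hzd k
    rw [← ENNReal.ofReal_toReal hc_top, edist_lt_ofReal] at this
    exact this.le
  obtain ⟨a, -, ψ, hψ, hlim⟩ := tendsto_subseq_of_bounded isBounded_closedBall hball
  have ha : a ∈ seqLimsup Fs :=
    mem_seqLimsup_of_tendsto (hφ.comp hψ) (x := z ∘ ψ) (fun k => hzF (ψ k)) hlim
  have hya : edist y a ≤ c := by
    refine le_of_tendsto (tendsto_const_nhds.edist hlim) (Eventually.of_forall fun k => ?_)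
    exact (hzd (ψ k)).le
  exact (lt_irrefl _) (((infEDist_le_edist_of_mem (h ha)).trans hya).trans_lt hc2)

/-- **Lemma 5.1.11**, "consequently" (converse direction, proper metric spaces): if
`limᵢ Fᵢ = F` then `d(Fᵢ; y) → d(F; y)` for every `y`. [cite: BorweinZhu2005, Lemma 5.1.11] -/
theorem tendsto_infEDist_of_isSeqLimit {Fs : ℕ → Set Y} {F : Set Y} (h : IsSeqLimit Fs F)
    (y : Y) : Tendsto (fun i => infEDist y (Fs i)) atTop (𝓝 (infEDist y F)) := by
  rw [isSeqLimit_iff] at h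
  exact tendsto_of_le_liminf_of_limsup_le (infEDist_le_liminf_of_seqLimsup_subset h.1 y)
    (subset_seqLiminf_iff.1 h.2 y)

end Proper

/-! ## Definition 5.1.12: epigraphs and epi-limits -/

section Epi

variable {X : Type*}

/-- The epigraph `epi h = {(x, r) ∈ X × ℝ | h x ≤ r}` of an extended-real-valued function.
[cite: BorweinZhu2005, Def 5.1.12] -/
def epi (h : X → EReal) : Set (X × ℝ) := {p | h p.1 ≤ (p.2 : EReal)}

/-- Unfolding of `epi`. [cite: BorweinZhu2005, Def 5.1.12] -/
theorem mem_epi_iff {h : X → EReal} {p : X × ℝ} : p ∈ epi h ↔ h p.1 ≤ (p.2 : EReal) := Iff.rfl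

/-- In `[−∞, +∞]`, `a ≤ b` as soon as every real upper bound of `b` bounds `a`. [folklore] -/
private theorem ereal_le_of_forall_coe_le {a b : EReal} (h : ∀ r : ℝ, b ≤ r → a ≤ r) : a ≤ b := by
  induction b using EReal.rec with
  | bot =>
    refine ((EReal.eq_bot_iff_forall_lt a).2 fun r => ?_).le
    exact (h (r - 1) bot_le).trans_lt (EReal.coe_lt_coe_iff.2 (sub_one_lt r))
  | coe r => exact h r le_rfl
  | top => exact le_top

/-- A function is determined by its epigraph. [cite: BorweinZhu2005, Def 5.1.12] -/
theorem eq_of_epi_eq {g g' : X → EReal} (h : epi g = epi g') : g = g' := by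
  funext x
  have hx : ∀ r : ℝ, g x ≤ r ↔ g' x ≤ r := fun r => by
    change (x, r) ∈ epi g ↔ (x, r) ∈ epi g'
    rw [h]
  exact le_antisymm (ereal_le_of_forall_coe_le fun r hr => (hx r).2 hr)
    (ereal_le_of_forall_coe_le fun r hr => (hx r).1 hr)

/-- `argmin h = {x | h x = inf h}`, the set of (global) minimisers.
[cite: BorweinZhu2005, Thm 5.1.14 & Example 5.1.2] -/
def argmin (h : X → EReal) : Set X := {x | ∀ y, h x ≤ h y}

/-- Unfolding of `argmin`. [cite: BorweinZhu2005, Thm 5.1.14] -/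
theorem mem_argmin_iff {h : X → EReal} {x : X} : x ∈ argmin h ↔ ∀ y, h x ≤ h y := Iff.rfl

variable [TopologicalSpace X]

/-- `g` is the **lower epi-limit** `e-lim infᵢ fᵢ`: `epi g = lim supᵢ (epi fᵢ)`.
[cite: BorweinZhu2005, Def 5.1.12] -/
def IsLowerEpiLimit (f : ℕ → X → EReal) (g : X → EReal) : Prop :=
  epi g = seqLimsup fun i => epi (f i)

/-- `g` is the **upper epi-limit** `e-lim supᵢ fᵢ`: `epi g = lim infᵢ (epi fᵢ)`.
[cite: BorweinZhu2005, Def 5.1.12] -/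
def IsUpperEpiLimit (f : ℕ → X → EReal) (g : X → EReal) : Prop :=
  epi g = seqLiminf fun i => epi (f i)

/-- `fᵢ` **epi-converges** to `g` (`g = e-limᵢ fᵢ`): `g` is both the lower and the upper epi-limit.
[cite: BorweinZhu2005, Def 5.1.12] -/
def EpiConverges (f : ℕ → X → EReal) (g : X → EReal) : Prop :=
  IsLowerEpiLimit f g ∧ IsUpperEpiLimit f g

/-- Lower epi-limits are unique. [cite: BorweinZhu2005, Def 5.1.12] -/
theorem IsLowerEpiLimit.unique {f : ℕ → X → EReal} {g g' : X → EReal} (h : IsLowerEpiLimit f g)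
    (h' : IsLowerEpiLimit f g') : g = g' :=
  eq_of_epi_eq (h.trans h'.symm)

/-- Upper epi-limits are unique. [cite: BorweinZhu2005, Def 5.1.12] -/
theorem IsUpperEpiLimit.unique {f : ℕ → X → EReal} {g g' : X → EReal} (h : IsUpperEpiLimit f g)
    (h' : IsUpperEpiLimit f g') : g = g' :=
  eq_of_epi_eq (h.trans h'.symm)

/-- `fᵢ` epi-converges to `g` iff `lim sup (epi fᵢ) ⊆ epi g ⊆ lim inf (epi fᵢ)`, i.e. iff `epi g` is
the Painlevé–Kuratowski limit of `(epi fᵢ)`. [cite: BorweinZhu2005, Def 5.1.12] -/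
theorem epiConverges_iff_subset {f : ℕ → X → EReal} {g : X → EReal} :
    EpiConverges f g ↔
      (seqLimsup fun i => epi (f i)) ⊆ epi g ∧ epi g ⊆ seqLiminf fun i => epi (f i) := by
  have h := isSeqLimit_iff (F := fun i => epi (f i)) (S := epi g)
  unfold IsSeqLimit at h
  unfold EpiConverges IsLowerEpiLimit IsUpperEpiLimit
  rw [← h]
  constructor
  · rintro ⟨h₁, h₂⟩; exact ⟨h₂.symm, h₁.symm⟩
  · rintro ⟨h₁, h₂⟩; exact ⟨h₂.symm, h₁.symm⟩

/-- A function with closed epigraph (in `X × ℝ`) is lower semicontinuous.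
[cite: BorweinZhu2005, Exercise 5.1.11] -/
theorem lowerSemicontinuous_of_isClosed_epi {g : X → EReal} (h : IsClosed (epi g)) :
    LowerSemicontinuous g := by
  intro x y hy
  obtain ⟨r, hyr, hrx⟩ := EReal.lt_iff_exists_real_btwn.1 hy
  have hnot : (x, r) ∉ epi g := fun hmem => (not_le.2 hrx) hmem
  have hopen : (epi g)ᶜ ∈ 𝓝 (x, r) := h.isOpen_compl.mem_nhds hnot
  obtain ⟨u, hu, v, hv, huv⟩ := mem_nhds_prod_iff.1 hopen
  filter_upwards [hu] with x' hx'
  have h' : (x', r) ∉ epi g := huv (mk_mem_prod hx' (mem_of_mem_nhds hv))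
  exact hyr.trans (not_le.1 h')

/-- The epigraph of a lower semicontinuous function is closed in `X × ℝ`.
[cite: BorweinZhu2005, Exercise 5.1.11] -/
theorem isClosed_epi_of_lowerSemicontinuous {g : X → EReal} (h : LowerSemicontinuous g) :
    IsClosed (epi g) :=
  h.isClosed_epigraph.preimage
    (continuous_fst.prodMk (continuous_coe_real_ereal.comp continuous_snd))

end Epi

/-! ## Exercise 5.1.11 and Lemma 5.1.13 in metric spaces -/

section EpiMetric

open Metric

variable {X : Type*} [PseudoMetricSpace X]

/-- **Exercise 5.1.11**: a lower epi-limit is lower semicontinuous.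
[cite: BorweinZhu2005, Exercise 5.1.11] -/
theorem IsLowerEpiLimit.lowerSemicontinuous {f : ℕ → X → EReal} {g : X → EReal}
    (h : IsLowerEpiLimit f g) : LowerSemicontinuous g :=
  lowerSemicontinuous_of_isClosed_epi (h ▸ isClosed_seqLimsup _)

/-- **Exercise 5.1.11**: an upper epi-limit is lower semicontinuous.
[cite: BorweinZhu2005, Exercise 5.1.11] -/
theorem IsUpperEpiLimit.lowerSemicontinuous {f : ℕ → X → EReal} {g : X → EReal}
    (h : IsUpperEpiLimit f g) : LowerSemicontinuous g :=
  lowerSemicontinuous_of_isClosed_epi (h ▸ isClosed_seqLiminf _)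

/-- **Exercise 5.1.11**: an epi-limit is lower semicontinuous.
[cite: BorweinZhu2005, Exercise 5.1.11] -/
theorem EpiConverges.lowerSemicontinuous {f : ℕ → X → EReal} {g : X → EReal}
    (h : EpiConverges f g) : LowerSemicontinuous g :=
  h.1.lowerSemicontinuous

/-- Padding a subsequence: a sequence `u_k → y` sitting at strictly increasing positions `φ k`
extends to a full sequence `xᵢ → y` with `x_{φ k} = u_k`. [folklore] -/
private theorem exists_extend_tendsto {Z : Type*} [TopologicalSpace Z] {φ : ℕ → ℕ}
    (hφ : StrictMono φ) {u : ℕ → Z} {y : Z} (hu : Tendsto u atTop (𝓝 y)) :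
    ∃ x : ℕ → Z, (∀ k, x (φ k) = u k) ∧ Tendsto x atTop (𝓝 y) := by
  classical
  refine ⟨fun i => if h : ∃ k, φ k = i then u h.choose else y, fun k => ?_, ?_⟩
  · have h : ∃ k', φ k' = φ k := ⟨k, rfl⟩
    show (if h : ∃ k', φ k' = φ k then u h.choose else y) = u k
    rw [dif_pos h, hφ.injective h.choose_spec]
  · intro s hs
    obtain ⟨K, hK⟩ := eventually_atTop.1 (hu hs)
    refine mem_map.2 (eventually_atTop.2 ⟨φ K, fun i hi => ?_⟩)
    change (if h : ∃ k, φ k = i then u h.choose else y) ∈ s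
    by_cases h : ∃ k, φ k = i
    · rw [dif_pos h]
      refine hK _ (hφ.le_iff_le.1 ?_)
      rw [h.choose_spec]
      exact hi
    · rw [dif_neg h]
      exact mem_of_mem_nhds hs

/-- `lim inf` along the whole sequence is below `lim inf` along a subsequence. [folklore] -/
private theorem liminf_le_liminf_comp {a : ℕ → EReal} {φ : ℕ → ℕ} (hφ : StrictMono φ) :
    liminf a atTop ≤ liminf (a ∘ φ) atTop := by
  refine le_of_forall_lt fun c hc => ?_
  obtain ⟨d, hcd, hd⟩ := exists_between hc
  refine hcd.trans_le (le_liminf_of_le (h := ?_))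
  exact (hφ.tendsto_atTop.eventually (eventually_lt_of_lt_liminf hd)).mono fun k hk => hk.le

/-- `lim sup` along a subsequence is below `lim sup` along the whole sequence. [folklore] -/
private theorem limsup_comp_le_limsup {a : ℕ → EReal} {φ : ℕ → ℕ} (hφ : StrictMono φ) :
    limsup (a ∘ φ) atTop ≤ limsup a atTop := by
  refine le_of_forall_gt_imp_ge_of_dense fun c hc => limsup_le_of_le (h := ?_)
  exact (hφ.tendsto_atTop.eventually (eventually_lt_of_limsup_lt hc)).mono fun k hk => hk.le

/-- **Lemma 5.1.13**, lower epi-limit ⇒ (5.1.9): if `epi g = lim sup (epi fᵢ)` then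
`g(x) ≤ lim infᵢ fᵢ(xᵢ)` for every sequence `xᵢ → x`. [cite: BorweinZhu2005, Lemma 5.1.13] -/
theorem IsLowerEpiLimit.le_liminf {f : ℕ → X → EReal} {g : X → EReal} (h : IsLowerEpiLimit f g)
    {x : X} {u : ℕ → X} (hu : Tendsto u atTop (𝓝 x)) :
    g x ≤ liminf (fun i => f i (u i)) atTop := by
  by_contra hlt
  rw [not_le] at hlt
  obtain ⟨r, hr1, hr2⟩ := EReal.lt_iff_exists_real_btwn.1 hlt
  obtain ⟨φ, hφ, hφr⟩ := extraction_of_frequently_atTop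
    (frequently_lt_of_liminf_lt (h := hr1))
  have hmem : (x, r) ∈ seqLimsup fun i => epi (f i) :=
    mem_seqLimsup_of_tendsto hφ (x := fun k => (u (φ k), r)) (fun k => (hφr k).le)
      ((hu.comp hφ.tendsto_atTop).prodMk_nhds tendsto_const_nhds)
  rw [← h] at hmem
  exact (lt_irrefl _) (hr2.trans_le hmem)

/-- (5.1.9) ⇒ `lim sup (epi fᵢ) ⊆ epi g` (half of **Lemma 5.1.13**, any topological space `X`
would do). [cite: BorweinZhu2005, Lemma 5.1.13 & Exercise 5.1.12] -/
theorem seqLimsup_epi_subset_of_le_liminf {f : ℕ → X → EReal} {g : X → EReal}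
    (h : ∀ (x : X) (u : ℕ → X), Tendsto u atTop (𝓝 x) → g x ≤ liminf (fun i => f i (u i)) atTop) :
    (seqLimsup fun i => epi (f i)) ⊆ epi g := by
  rintro ⟨y, r⟩ hp
  obtain ⟨φ, hφ, p, hp, hpy⟩ := mem_seqLimsup_iff_strictMono.1 hp
  obtain ⟨xs, hxs, hxsy⟩ := exists_extend_tendsto hφ ((continuous_fst.tendsto _).comp hpy)
  have hr : Tendsto (fun k => ((p k).2 : EReal)) atTop (𝓝 (r : EReal)) :=
    (continuous_coe_real_ereal.tendsto _).comp ((continuous_snd.tendsto _).comp hpy)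
  change g y ≤ r
  calc g y ≤ liminf (fun i => f i (xs i)) atTop := h y xs hxsy
    _ ≤ liminf ((fun i => f i (xs i)) ∘ φ) atTop := liminf_le_liminf_comp hφ
    _ ≤ liminf (fun k => ((p k).2 : EReal)) atTop := by
        refine liminf_le_liminf (Eventually.of_forall fun k => ?_)
        change f (φ k) (xs (φ k)) ≤ _
        rw [hxs k]
        exact hp k
    _ = r := hr.liminf_eq

/-- A diagonal extraction: countably many eventually-true properties can be realised along one
sequence of indices `N i → ∞`. [folklore] -/
private theorem exists_tendsto_eventually {P : ℕ → ℕ → Prop} (h : ∀ n, ∀ᶠ i in atTop, P n i) :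
    ∃ N : ℕ → ℕ, Tendsto N atTop atTop ∧ ∀ᶠ i in atTop, P (N i) i := by
  classical
  choose M hM using fun n => eventually_atTop.1 (h n)
  refine ⟨fun i => Nat.findGreatest (fun n => M n ≤ i) i, ?_, ?_⟩
  · refine tendsto_atTop_atTop.2 fun m => ⟨max (M m) m, fun i hi => ?_⟩
    exact Nat.le_findGreatest ((le_max_right _ _).trans hi) ((le_max_left _ _).trans hi)
  · refine eventually_atTop.2 ⟨M 0, fun i hi => hM _ _ ?_⟩
    exact Nat.findGreatest_spec (P := fun n => M n ≤ i) (Nat.zero_le i) hi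

/-- **Lemma 5.1.13**, upper epi-limit ⇒ (5.1.10): if `epi g = lim inf (epi fᵢ)` then for every
`x` there is a sequence `xᵢ → x` with `lim supᵢ fᵢ(xᵢ) ≤ g(x)`.
[cite: BorweinZhu2005, Lemma 5.1.13] -/
theorem IsUpperEpiLimit.exists_limsup_le {f : ℕ → X → EReal} {g : X → EReal}
    (h : IsUpperEpiLimit f g) (x : X) :
    ∃ u : ℕ → X, Tendsto u atTop (𝓝 x) ∧ limsup (fun i => f i (u i)) atTop ≤ g x := by
  induction hx : g x using EReal.rec with
  | top => exact ⟨fun _ => x, tendsto_const_nhds, le_top⟩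
  | coe r =>
    have hmem : (x, r) ∈ seqLiminf fun i => epi (f i) := by
      rw [← h]
      exact hx.le
    obtain ⟨p, hp, hpx⟩ := hmem
    refine ⟨fun i => (p i).1, (continuous_fst.tendsto _).comp hpx, ?_⟩
    have hr : Tendsto (fun i => ((p i).2 : EReal)) atTop (𝓝 (r : EReal)) :=
      (continuous_coe_real_ereal.tendsto _).comp ((continuous_snd.tendsto _).comp hpx)
    calc limsup (fun i => f i (p i).1) atTop ≤ limsup (fun i => ((p i).2 : EReal)) atTop :=
          limsup_le_limsup hp
      _ = r := hr.limsup_eq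
  | bot =>
    -- `(x, -n) ∈ epi g = lim inf (epi fᵢ)` for every `n`; diagonalise.
    have hmem : ∀ n : ℕ, (x, -(n : ℝ)) ∈ seqLiminf fun i => epi (f i) := fun n => by
      rw [← h]
      change g x ≤ _
      rw [hx]
      exact bot_le
    have hP : ∀ n : ℕ, ∀ᶠ i in atTop,
        infEDist (x, -(n : ℝ)) (epi (f i)) < ((n : ℝ≥0∞) + 1)⁻¹ := fun n =>
      (tendsto_order.1 (mem_seqLiminf_iff_tendsto_infEDist.1 (hmem n))).2 _
        (ENNReal.inv_pos.2 (by simp))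
    obtain ⟨N, hN, hNP⟩ := exists_tendsto_eventually hP
    have hchoice : ∀ i : ℕ, infEDist (x, -(N i : ℝ)) (epi (f i)) < ((N i : ℝ≥0∞) + 1)⁻¹ →
        ∃ p ∈ epi (f i), edist (x, -(N i : ℝ)) p < ((N i : ℝ≥0∞) + 1)⁻¹ := fun i hi =>
      infEDist_lt_iff.1 hi
    haveI : Nonempty (X × ℝ) := ⟨(x, 0)⟩
    choose! p hpF hpd using hchoice
    have hinv : Tendsto (fun i => ((N i : ℝ≥0∞) + 1)⁻¹) atTop (𝓝 0) :=
      tendsto_inv_natCast_succ.comp hN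
    refine ⟨fun i => (p i).1, ?_, ?_⟩
    · rw [tendsto_iff_edist_tendsto_0]
      refine tendsto_of_tendsto_of_tendsto_of_le_of_le' tendsto_const_nhds hinv
        (Eventually.of_forall fun i => zero_le) ?_
      filter_upwards [hNP] with i hi
      calc edist (p i).1 x = edist x (p i).1 := edist_comm _ _
        _ ≤ edist (x, -(N i : ℝ)) (p i) := by
            rw [Prod.edist_eq]; exact le_max_left _ _
        _ ≤ _ := (hpd i hi).le
    · -- `fᵢ(uᵢ) ≤ (p i).2 < 1 - N i → -∞`
      have hbound : ∀ᶠ i in atTop, f i (p i).1 ≤ ((1 - (N i : ℝ) : ℝ) : EReal) := by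
        filter_upwards [hNP] with i hi
        have h2 : edist (-(N i : ℝ)) (p i).2 < ENNReal.ofReal 1 := by
          calc edist (-(N i : ℝ)) (p i).2 ≤ edist (x, -(N i : ℝ)) (p i) := by
                rw [Prod.edist_eq]; exact le_max_right _ _
            _ < ((N i : ℝ≥0∞) + 1)⁻¹ := hpd i hi
            _ ≤ 1 := ENNReal.inv_le_one.2 (by simp)
            _ = ENNReal.ofReal 1 := ENNReal.ofReal_one.symm
        rw [edist_lt_ofReal, Real.dist_eq, abs_lt] at h2
        refine (hpF i hi).trans (EReal.coe_le_coe_iff.2 ?_)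
        linarith [h2.1, h2.2]
      show limsup (fun i => f i (p i).1) atTop ≤ ⊥
      refine le_of_eq ((EReal.eq_bot_iff_forall_lt _).2 fun r => ?_)
      have hNr : ∀ᶠ i in atTop, ((1 - (N i : ℝ) : ℝ) : EReal) ≤ ((r - 1 : ℝ) : EReal) := by
        have := hN.eventually (eventually_ge_atTop (⌈(2 : ℝ) - r⌉₊))
        filter_upwards [this] with i hi
        refine EReal.coe_le_coe_iff.2 ?_
        have : (2 : ℝ) - r ≤ N i := (Nat.le_ceil _).trans (by exact_mod_cast hi)
        linarith
      calc limsup (fun i => f i (p i).1) atTop ≤ ((r - 1 : ℝ) : EReal) :=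
            limsup_le_of_le (h := (hbound.and hNr).mono fun i hi => hi.1.trans hi.2)
        _ < r := EReal.coe_lt_coe_iff.2 (sub_one_lt r)

/-- (5.1.10) ⇒ `epi g ⊆ lim inf (epi fᵢ)` (half of **Lemma 5.1.13**).
[cite: BorweinZhu2005, Lemma 5.1.13 & Exercise 5.1.12] -/
theorem epi_subset_seqLiminf_of_exists_limsup_le {f : ℕ → X → EReal} {g : X → EReal}
    (h : ∀ x : X, ∃ u : ℕ → X, Tendsto u atTop (𝓝 x) ∧ limsup (fun i => f i (u i)) atTop ≤ g x) :
    epi g ⊆ seqLiminf fun i => epi (f i) := by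
  rintro ⟨y, r⟩ hyr
  change g y ≤ r at hyr
  obtain ⟨u, hu, hlim⟩ := h y
  have hlim' : limsup (fun i => f i (u i)) atTop ≤ r := hlim.trans hyr
  -- real upper bounds `rᵢ → r` with `fᵢ(uᵢ) ≤ rᵢ` eventually
  set a : ℕ → EReal := fun i => f i (u i) with ha
  have hev : ∀ ε : ℝ, 0 < ε → ∀ᶠ i in atTop, a i < ((r + ε : ℝ) : EReal) := fun ε hε =>
    eventually_lt_of_limsup_lt (hlim'.trans_lt (EReal.coe_lt_coe_iff.2 (by linarith)))
  refine ⟨fun i => (u i, (max (a i) r).toReal), ?_, hu.prodMk_nhds ?_⟩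
  · filter_upwards [hev 1 one_pos] with i hi
    change f i (u i) ≤ ((max (a i) r).toReal : EReal)
    rw [EReal.coe_toReal (ne_top_of_lt (max_lt hi (EReal.coe_lt_coe_iff.2 (by linarith))))
      (ne_bot_of_gt (lt_max_of_lt_right (EReal.bot_lt_coe r)))]
    exact le_max_left _ _
  · rw [Metric.tendsto_atTop]
    intro ε hε
    obtain ⟨M, hM⟩ := eventually_atTop.1 (hev ε hε)
    refine ⟨M, fun i hi => ?_⟩
    have htop : max (a i) r ≠ ⊤ :=
      ne_top_of_lt (max_lt (hM i hi) (EReal.coe_lt_coe_iff.2 (by linarith)))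
    have hbot : max (a i) r ≠ ⊥ := ne_bot_of_gt (lt_max_of_lt_right (EReal.bot_lt_coe r))
    have h1 : r ≤ (max (a i) r).toReal := by
      have := le_max_right (a i) (r : EReal)
      rw [← EReal.coe_toReal htop hbot] at this
      exact EReal.coe_le_coe_iff.1 this
    have h2 : (max (a i) r).toReal < r + ε := by
      have := max_lt (hM i hi) (EReal.coe_lt_coe_iff.2 (by linarith : r < r + ε))
      rw [← EReal.coe_toReal htop hbot] at this
      exact EReal.coe_lt_coe_iff.1 this
    rw [Real.dist_eq, abs_lt]
    constructor <;> linarith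

/-- **Lemma 5.1.13** (characterisation of epi-limits): `fᵢ` epi-converges to `g` iff at each `x`,
(5.1.9) `g(x) ≤ lim infᵢ fᵢ(xᵢ)` for every sequence `xᵢ → x`, and (5.1.10)
`lim supᵢ fᵢ(xᵢ) ≤ g(x)` for some sequence `xᵢ → x`.
[cite: BorweinZhu2005, Lemma 5.1.13 & Exercise 5.1.12] -/
theorem epiConverges_iff {f : ℕ → X → EReal} {g : X → EReal} :
    EpiConverges f g ↔
      (∀ (x : X) (u : ℕ → X), Tendsto u atTop (𝓝 x) → g x ≤ liminf (fun i => f i (u i)) atTop) ∧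
      ∀ x : X, ∃ u : ℕ → X, Tendsto u atTop (𝓝 x) ∧ limsup (fun i => f i (u i)) atTop ≤ g x := by
  constructor
  · rintro ⟨h₁, h₂⟩
    exact ⟨fun x u hu => h₁.le_liminf hu, fun x => h₂.exists_limsup_le x⟩
  · rintro ⟨h₁, h₂⟩
    exact epiConverges_iff_subset.2
      ⟨seqLimsup_epi_subset_of_le_liminf h₁, epi_subset_seqLiminf_of_exists_limsup_le h₂⟩

/-! ## Theorem 5.1.14: epi-convergence and minimisation -/

/-- **Theorem 5.1.14**, (5.1.13): epi-convergence alone gives `lim supᵢ inf fᵢ ≤ inf g`.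
[cite: BorweinZhu2005, Thm 5.1.14 (5.1.13)] -/
theorem EpiConverges.limsup_iInf_le {f : ℕ → X → EReal} {g : X → EReal} (h : EpiConverges f g) :
    limsup (fun i => ⨅ x, f i x) atTop ≤ ⨅ x, g x := by
  refine le_iInf fun x => ?_
  obtain ⟨u, -, hlim⟩ := h.2.exists_limsup_le x
  exact (limsup_le_limsup (Eventually.of_forall fun i => iInf_le (fun x => f i x) (u i))).trans hlim

/-- **Theorem 5.1.14**, (5.1.14): if moreover all `dom fᵢ` lie in a compact set `E`, then
`inf g ≤ lim infᵢ inf fᵢ`. [cite: BorweinZhu2005, Thm 5.1.14 (5.1.14)] -/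
theorem EpiConverges.iInf_le_liminf_iInf {f : ℕ → X → EReal} {g : X → EReal}
    (h : EpiConverges f g) {E : Set X} (hE : IsCompact E)
    (hdom : ∀ i x, f i x < ⊤ → x ∈ E) :
    ⨅ x, g x ≤ liminf (fun i => ⨅ x, f i x) atTop := by
  by_contra hlt
  rw [not_le] at hlt
  obtain ⟨r, hr1, hr2⟩ := EReal.lt_iff_exists_real_btwn.1 hlt
  obtain ⟨φ, hφ, hφr⟩ := extraction_of_frequently_atTop
    (frequently_lt_of_liminf_lt (h := hr1))
  have hchoice : ∀ k, ∃ v, f (φ k) v < r := fun k => iInf_lt_iff.1 (hφr k)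
  choose v hv using hchoice
  have hvE : ∀ k, v k ∈ E := fun k => hdom _ _ ((hv k).trans (EReal.coe_lt_top r))
  obtain ⟨a, -, ψ, hψ, hlim⟩ := hE.tendsto_subseq hvE
  have hmem : (a, r) ∈ seqLimsup fun i => epi (f i) :=
    mem_seqLimsup_of_tendsto (hφ.comp hψ) (x := fun k => (v (ψ k), r)) (fun k => (hv (ψ k)).le)
      (hlim.prodMk_nhds tendsto_const_nhds)
  rw [← h.1] at hmem
  exact (lt_irrefl _) ((hr2.trans_le (iInf_le _ a)).trans_le hmem)

/-- **Theorem 5.1.14**, (5.1.11): if `fᵢ` epi-converges to `g` and all `dom fᵢ` lie in a compact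
set `E`, then `limᵢ inf fᵢ = inf g`. [cite: BorweinZhu2005, Thm 5.1.14 (5.1.11)] -/
theorem EpiConverges.tendsto_iInf {f : ℕ → X → EReal} {g : X → EReal} (h : EpiConverges f g)
    {E : Set X} (hE : IsCompact E) (hdom : ∀ i x, f i x < ⊤ → x ∈ E) :
    Tendsto (fun i => ⨅ x, f i x) atTop (𝓝 (⨅ x, g x)) :=
  tendsto_of_le_liminf_of_limsup_le (h.iInf_le_liminf_iInf hE hdom) h.limsup_iInf_le

/-- **Theorem 5.1.14**, (5.1.12): if `fᵢ` epi-converges to `g` then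
`lim supᵢ (argmin fᵢ) ⊆ argmin g` (no compactness needed, as remarked after the proof).
[cite: BorweinZhu2005, Thm 5.1.14 (5.1.12)] -/
theorem EpiConverges.seqLimsup_argmin_subset {f : ℕ → X → EReal} {g : X → EReal}
    (h : EpiConverges f g) : (seqLimsup fun i => argmin (f i)) ⊆ argmin g := by
  intro xbar hx y
  obtain ⟨φ, hφ, w, hw, hwx⟩ := mem_seqLimsup_iff_strictMono.1 hx
  obtain ⟨xs, hxs, hxsx⟩ := exists_extend_tendsto hφ hwx
  obtain ⟨u, hu, hlim⟩ := h.2.exists_limsup_le y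
  calc g xbar ≤ liminf (fun i => f i (xs i)) atTop := h.1.le_liminf hxsx
    _ ≤ liminf ((fun i => f i (xs i)) ∘ φ) atTop := liminf_le_liminf_comp hφ
    _ ≤ liminf ((fun i => f i (u i)) ∘ φ) atTop := by
        refine liminf_le_liminf (Eventually.of_forall fun k => ?_)
        change f (φ k) (xs (φ k)) ≤ f (φ k) (u (φ k))
        rw [hxs k]
        exact hw k _
    _ ≤ limsup ((fun i => f i (u i)) ∘ φ) atTop := liminf_le_limsup
    _ ≤ limsup (fun i => f i (u i)) atTop := limsup_comp_le_limsup hφ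
    _ ≤ g y := hlim

end EpiMetric

/-! ## Exercise 5.1.13: the compactness condition in Theorem 5.1.14 cannot be dropped -/

section Counterexample

/-- **Exercise 5.1.13**: on `X = ℝ` the indicator functions `fᵢ = ι_{{i}}` epi-converge to the
constant `+∞` (their epigraphs `{i} × [0, ∞)` escape to infinity), yet `inf fᵢ = 0` does not tend
to `inf (+∞) = +∞`; so (5.1.11) fails without the compact set `E`.
[cite: BorweinZhu2005, Exercise 5.1.13] -/
theorem exists_epiConverges_not_tendsto_iInf :
    ∃ (f : ℕ → ℝ → EReal) (g : ℝ → EReal), EpiConverges f g ∧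
      ¬ Tendsto (fun i => ⨅ x, f i x) atTop (𝓝 (⨅ x, g x)) := by
  classical
  refine ⟨fun i x => if x = i then 0 else ⊤, fun _ => ⊤, ?_, ?_⟩
  · -- both set limits of the epigraphs are empty, as is `epi ⊤`
    have hepi : epi (fun _ : ℝ => (⊤ : EReal)) = ∅ := by
      ext p
      simp only [mem_epi_iff, top_le_iff, EReal.coe_ne_top, mem_empty_iff_false]
    have hsup :
        (seqLimsup fun i => epi (fun x : ℝ => if x = (i : ℝ) then (0 : EReal) else ⊤)) = ∅ := by
      refine eq_empty_iff_forall_notMem.2 fun q hq => ?_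
      obtain ⟨φ, hφ, p, hp, hpq⟩ := mem_seqLimsup_iff_strictMono.1 hq
      have hp1 : ∀ k, (p k).1 = (φ k : ℝ) := fun k => by
        by_contra hne
        have := hp k
        rw [mem_epi_iff, if_neg hne, top_le_iff] at this
        exact EReal.coe_ne_top _ this
      have h1 : Tendsto (fun k => (p k).1) atTop (𝓝 q.1) := (continuous_fst.tendsto _).comp hpq
      have h2 : Tendsto (fun k => (p k).1) atTop atTop := by
        simp_rw [hp1]
        exact tendsto_natCast_atTop_atTop.comp hφ.tendsto_atTop
      exact not_tendsto_nhds_of_tendsto_atTop h2 _ h1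
    refine epiConverges_iff_subset.2 ⟨?_, ?_⟩
    · rw [hsup]; exact empty_subset _
    · rw [hepi]; exact empty_subset _
  · have hinf : ∀ i : ℕ, (⨅ x : ℝ, (if x = (i : ℝ) then (0 : EReal) else ⊤)) = 0 := fun i => by
      refine le_antisymm ((iInf_le _ (i : ℝ)).trans (by simp)) (le_iInf fun x => ?_)
      split_ifs
      · exact le_rfl
      · exact le_top
    have hg : (⨅ _ : ℝ, (⊤ : EReal)) = ⊤ := iInf_const
    simp_rw [hinf, hg]
    intro h
    have := tendsto_nhds_unique h tendsto_const_nhds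
    exact EReal.zero_ne_top this.symm

end Counterexample

end Literature.Analysis.Convex.PainleveKuratowskiEpiConvergence
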